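import Summits.Schanuel.Schanuel.Theorems.RootDecomp1KHyperellipticSiegel02

/-!
# RootDecomp1KHyperellipticSiegel — lens 1, generation 62, NODE 23 «HYPERELLIPTIC SIEGEL ON THE K-LINE — the dominant live sector» (Siegel's theorem for y² = f(x), f separable of degree ≥ 3, over any number field — AEC IX.4.3 — PROVED from the tree's unit equation and cubic case; the engine on DOMINANT x-degree-2 pairs c₂x² + c₁x + c₀ (deg c₁, deg c₂ < deg c₀) with separable x-discriminant of degree ≥ 3 ⇒ SiegelClause / LevelFinite / ThinFibreAt ∀ m₀ / BddLevelEmpty, intrinsically the class DomHyper P; the genus-two family M j := x² + 3Y·x + (Y⁵ + 9jY + 9j + 3) decided hypothesis-free ∀ j ∈ ℤ; the territory M_territory incl. 2-adic liveness by size at m₀ = 2; CLAIM L2879, PRICE L2882, K-R54) — continuation (RootDecomp1KHyperellipticSiegel03): §F the family M j := x² + 3Y·x + (Y⁵ + 9jY + 9j + 3): mQ / mC / M / mD, pDisc_mC, the uniform 3-Eisenstein certificate isEisensteinAt_mD ⇒ irreducible_mD_rat / separable_mD_rat, domZero_mC, domHyper_M, levelFinite_M / thinFibreAt_M / bddLevelEmpty_M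 / siegelClause_M / finite_dyadicPoints_M (section Family)

(lens-1 g62 NODE 23 «HYPERELLIPTIC SIEGEL ON THE K-LINE — the DOMINANT LIVE SECTOR» L2903: HOME kernel K = HOME/decomp-schanuel-lens-1/g62/lean/HyperellipticSiegel.lean sha256 f4b0f073…, 1239 l, 124 theorems + 8 defs, ONE namespace `Summit.Schanuel.Schanuel.Theorems.RootDecomp1KHyperellipticSiegel`, imports the tree port …RootDecomp1KSiegelGenusOne05 ONLY (the PROVED Literature modules Literature.NumberTheory.DiophantineGeometry.{SiegelCubicReduction, UnitEquationFinite, SIntegersFiniteExtension} and EllipticCurves.{KummerSelmerGroupFinite, TwoDescentParity} arrive transitively, BUILT; no …Proofs umbrella, no fact file); no private, no instance, no set_option, no notation, no sorry, no native_decide / decide; farm of record (lens): K rc 0 · 0 errors · 0 sorries, Probe rc 0 (211 `#print axioms` guards, standard triple), Ctrl0 rc 0, Ctrl rc 1 = 42 planted errors exactly; CLAIM L2879, crit g11 PRICE L2882 (PAYABLE THEOREM ×1 EX ANTE for (L)+(E)+(F)+(T) jointly under K-R53 (iii) prong 4; CHECKLIST K-g62 (1)–(11); RULE K-R54 PRE-ANNOUNCED),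 census LIVENESS-v24/v25/v26 (rows M 67 / M 144 / X3; keys hsE / galq / genus_torus of record L2882 / L2893 / L2897), crit g12 RULING L2893 (X3 = standing witness of the dominant-far sector), ADVANCE NOTICE L2901 (a) (engine generality DomZero 2), writer g32/g33 NOTES 14 / 1 / 2 / 4 (pre-kernel arithmetic incl. the real place; X3 certificate; DomHyper flips), critic VERDICT (crit g12): CLEARED — THEOREM ×1 for (L)+(E)+(F)+(T) JOINTLY, ONE credit (K-R53 (iii) prong 4), VERDICT L2907 (crit g12): CHECKLIST K-g62 (1)–(11) met item by item on the critic's own farm runs (K c679d0af… rc 0 · 0 errors · 0 sorries; Probe a3866a38… rc 0 with 211 `#print axioms` guards ⊆ the standard triple; Ctrl0 rc 0; Ctrl rc 1 = exactly the 42 planted errors; L_standalone rc 0 ⇒ §L uses nothing from the K-line); ERRATUM OF RECORD E1 = lens ADDENDUM 1 L2904 (memo only: (E) as typed = node 15's c₀-dominance `DomZero 2` reaches seven tabled LIVENESS rows — M 67, M 144 + the by-product rows contactC / highContactC / quinticP / RC2 / GC2 «reachable, not instantiated»); LABEL OF RECORD: literature KNOWN TOOL (Siegel 1926 / LeVeque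 1964; AEC IX.4.3; B–G 5.2.1 for U) · tree-NEW PROVED THEOREM · problem-relative NEW LEVER on the K-line (the first genus-≥ 2 class decided; integral-point Siegel consumed directly); TALLY lens-1 ×20 + THEOREM ×22; RULE K-R54 FIXED ((i) toolkit ∪= integral-point Siegel in general = ×0-as-record after node 23; (ii) open territory at m₀ = 2 := K-R53 (ii) territory not reached by (i) ∪ K-R53 (i), two named sectors with standing witnesses W4 (non-dominant) and X3 (dominant-far); (iii) payable clause; (iv) unconditional part ∪= the node-23 tree names after the port); lens DONE L2909; PORT GO L2908 exactly as census STAGING NOTE 13 L2905 (five parts; the one pre-emptive privatisation accepted; chain import as staged). Port by census-1 gen 24 per NODE-g62.md §(11) as `RootDecomp1KHyperellipticSiegel01–05` (`--supports stmt-Schanuel-33364`; the item stays OPEN; no census credit): 01 = §L Siegel's theorem for y² = f(x) in full (sections Parity, Cofactor; `exists_numberField_forall_isSquare_of_even`; `finite_integer_sq_eq_of_unitEquation` with the tree's U-binder verbatim; `finite_integer_sq_eq` unconditional) — the ONLY part whose proofs touch Literature names, all CITED by name (`finite_unitEquation`, `finite_integer_sq_eq_cubic_of_unitEquation`, `exists_numberField_forall_mem_selmerGroup_isSquare`,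 `exists_finite_forall_mem_integer_algebraMap`, `IsDedekindDomain.mk_mem_selmerGroup_iff`, `setOf_valuation_ne_one_finite`, `setOf_one_lt_valuation_finite`), never restated; 02 = §E the engine on dominant x-degree-2 pairs (`pDisc`, `xDisc_xPolyP_two`, `sq_eq_aeval_pDisc`, `den_dvd_of_dyadic`, `badT`, `ordinate_mem_integer`, `fibrePoly_ne_zero`, `finite_ordinates_dom2` … `finite_pointed_levels_dom2`) + §E′ the intrinsic class (`DomHyper`, `domHyper_xPolyP_iff`, `thinFibreAt_of_domHyper`, `levelFinite_of_domHyper`, `siegelClause_of_domHyper`, `bddLevelEmpty_of_domHyper`, …) (section Engine); 03 = §F the family M j (`mQ`, `mC`, `M`, `mD`, `isEisensteinAt_mD`, `domHyper_M`, `levelFinite_M`, `thinFibreAt_M`, `bddLevelEmpty_M`, `siegelClause_M`, `finite_dyadicPoints_M`) (section Family); 04 = §T part 1 (numerology, shape refusals, `presentation_M`, rootless / decided / slope / local / Gauss refusals, `thinFibreAt_M_of_three_le`, `irreducible_xDisc_M`) (section Territory, to be continued); 05 = §T part 2 (the anchor (1, −1), odd/tangent-emptiness refusals, real roots, (T-2)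 `den_pow_five_le_M` / `den_pow_lt_M` / `not_thin_ineq_two_M`, `thinFibreAt_two_iff_levelFinite_M`, `M_territory`, `M'`, `M'_zero` / `M'_one`, `M'_territory`) (section Territory re-opened with K's own open-lines). Text = K VERBATIM (every declaration of K is documented by the lens; statements and proofs unchanged; the module docstring of K kept in part 01 below this provenance block).)
-/

noncomputable section

namespace Summit.Schanuel.Schanuel.Theorems.RootDecomp1KHyperellipticSiegel

open Polynomial IsDedekindDomain NumberField
open scoped Classical WithZero
open Literature.NumberTheory.DiophantineGeometry (finite_integer_sq_eq_cubic_of_unitEquation finite_unitEquation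
  exists_numberField_forall_mem_selmerGroup_isSquare exists_finite_forall_mem_integer_algebraMap)
open IsDedekindDomain.HeightOneSpectrum (setOf_valuation_ne_one_finite setOf_one_lt_valuation_finite)

/-! ### §F  THE FAMILY `M j := x² + 3Y·x + (Y⁵ + 9j·Y + 9j + 3)`, `j ∈ ℤ` — GENUS TWO, DOMINANT, DECIDED -/

section Family

open LiouvilleNumber
open scoped Nat
open Summit.Schanuel.Schanuel.Theorems.RootDecomp1KDegreeLadder
open Summit.Schanuel.Schanuel.Theorems.RootDecomp1KXTop
open Summit.Schanuel.Schanuel.Theorems.RootDecomp1KXAll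
open Summit.Schanuel.Schanuel.Theorems.RootDecomp1KLevelFinite
open Summit.Schanuel.Schanuel.Theorems.RootDecomp1KIntegrality (DomZero GaussAt gaussAt_xPolyP_iff thinFibreAt_of_gaussAt)
open Summit.Schanuel.Schanuel.Theorems.RootDecomp1KHeightGrading (BddLevelEmpty bddLevelEmpty_iff_levelFinite)
open Summit.Schanuel.Schanuel.Theorems.RootDecomp1KCubicDescent (xDisc)

/-- [datum] `Q_j := Y⁵ + 9j·Y + (9j + 3)` — the constant `x`-coefficient (MONIC QUINTIC: dominant, ODD degree). -/
def mQ (j : ℤ) : ℤ[X] := X ^ 5 + C (9 * j) * X + C (9 * j + 3)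
/-- [datum] the `x`-coefficients of `M j`: `c₂ = 1`, `c₁ = 3Y`, `c₀ = Q_j`. -/
def mC (j : ℤ) : ℕ → ℤ[X] := fun i => if i = 2 then 1 else if i = 1 then C 3 * X else if i = 0 then mQ j else 0
/-- [datum] **THE FAMILY `M j := x² + 3Y·x + (Y⁵ + 9j·Y + 9j + 3)`**, `j ∈ ℤ` (CLAIM L2879). -/
def M (j : ℤ) : ℤ[X][X] := xPolyP 2 (mC j)
/-- [datum] `Δ_j := −4Y⁵ + 9Y² − 36j·Y − (36j + 12)` — the `x`-discriminant of `M j` (`pDisc_mC`, `xDisc_M`). -/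
def mD (j : ℤ) : ℤ[X] := C (-4) * X ^ 5 + C 9 * X ^ 2 + C (-(36 * j)) * X + C (-(36 * j + 12))

/-- `(j : ℤ) : mC j 2 = 1`. -/
@[simp] theorem mC_two (j : ℤ) : mC j 2 = 1 := by simp [mC]
/-- `(j : ℤ) : mC j 1 = C 3 * X`. -/
@[simp] theorem mC_one (j : ℤ) : mC j 1 = C 3 * X := by simp [mC]
/-- `(j : ℤ) : mC j 0 = mQ j`. -/
@[simp] theorem mC_zero (j : ℤ) : mC j 0 = mQ j := by simp [mC]
/-- `(j : ℤ) {i : ℕ} (hi : 2 < i) : mC j i = 0`. -/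
theorem mC_of_gt (j : ℤ) {i : ℕ} (hi : 2 < i) : mC j i = 0 := by
  simp [mC, show i ≠ 2 by omega, show i ≠ 1 by omega, show i ≠ 0 by omega]
/-- `(j : ℤ) : mC j 2 ≠ 0`. -/
theorem mC_two_ne_zero (j : ℤ) : mC j 2 ≠ 0 := by rw [mC_two]; exact one_ne_zero

/-- `(j : ℤ) : (mQ j).natDegree = 5`. -/
theorem natDegree_mQ (j : ℤ) : (mQ j).natDegree = 5 := by unfold mQ; compute_degree!
/-- `(j : ℤ) : (mQ j).coeff 5 = 1`. -/
theorem coeff_mQ_five (j : ℤ) : (mQ j).coeff 5 = 1 := by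
  rw [mQ]; simp only [coeff_add, coeff_X_pow, coeff_C_mul_X, coeff_C]; norm_num
/-- `(j : ℤ) : (mQ j).leadingCoeff = 1`. -/
theorem leadingCoeff_mQ (j : ℤ) : (mQ j).leadingCoeff = 1 := by rw [leadingCoeff, natDegree_mQ, coeff_mQ_five]
/-- `{R} [CommRing R] [Algebra ℤ R] (j : ℤ) (y : R) : aeval y (mQ j) = y ^ 5 + 9 * j * y + (9 * j + 3)`. -/
@[simp] theorem aeval_mQ {R : Type*} [CommRing R] [Algebra ℤ R] (j : ℤ) (y : R) :
    aeval y (mQ j) = y ^ 5 + 9 * (j : R) * y + (9 * (j : R) + 3) := by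
  simp [mQ, map_ofNat]

/-- `M j` evaluated: `y⁵ + 9j·y + (9j + 3) + x·(3y) + x²`. -/
theorem bev_M (j : ℤ) (x y : ℝ) : bev (M j) x y = y ^ 5 + 9 * j * y + (9 * j + 3) + x * (3 * y) + x ^ 2 := by
  rw [M, bev_xPolyP_two, mC_zero, mC_one, mC_two, aeval_mQ, map_mul, aeval_C, aeval_X, map_one]
  simp
/-- the RATIONAL identity at a rational point of `M j`. -/
theorem ratEq_M (j : ℤ) {ξ r : ℚ} (h : bev (M j) ξ r = 0) :
    r ^ 5 + 9 * j * r + (9 * j + 3) + ξ * (3 * r) + ξ ^ 2 = 0 := by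
  have h1 := ratEq_of_bev_two (c := mC j) h
  rw [mC_zero, mC_one, mC_two, aeval_mQ, map_mul, aeval_C, aeval_X, map_one] at h1
  simp only [algebraMap_int_eq, eq_intCast, Int.cast_ofNat] at h1
  linear_combination h1

/-- `(j : ℤ) : pDisc (mC j) = mD j` — `Δ_j` IS the engine's discriminant of the presentation. -/
theorem pDisc_mC (j : ℤ) : pDisc (mC j) = mD j := by
  rw [pDisc, mC_zero, mC_one, mC_two, mQ, mD]
  simp only [map_neg, map_mul, map_add, map_ofNat]
  ring
/-- `(j : ℤ) : xDisc (M j) = mD j` — and the tree's INTRINSIC `x`-discriminant of `M j`. -/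
theorem xDisc_M (j : ℤ) : xDisc (M j) = mD j := by rw [M, xDisc_xPolyP_two, pDisc_mC]

/-- `(j : ℤ) : (mD j).coeff 5 = -4`. -/
theorem coeff_mD_five (j : ℤ) : (mD j).coeff 5 = -4 := by
  rw [mD]; simp only [coeff_add, coeff_C_mul_X_pow, coeff_C_mul_X, coeff_C]; norm_num
/-- `(j : ℤ) : (mD j).coeff 4 = 0`. -/
theorem coeff_mD_four (j : ℤ) : (mD j).coeff 4 = 0 := by
  rw [mD]; simp only [coeff_add, coeff_C_mul_X_pow, coeff_C_mul_X, coeff_C]; norm_num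
/-- `(j : ℤ) : (mD j).coeff 3 = 0`. -/
theorem coeff_mD_three (j : ℤ) : (mD j).coeff 3 = 0 := by
  rw [mD]; simp only [coeff_add, coeff_C_mul_X_pow, coeff_C_mul_X, coeff_C]; norm_num
/-- `(j : ℤ) : (mD j).coeff 2 = 9`. -/
theorem coeff_mD_two (j : ℤ) : (mD j).coeff 2 = 9 := by
  rw [mD]; simp only [coeff_add, coeff_C_mul_X_pow, coeff_C_mul_X, coeff_C]; norm_num
/-- `(j : ℤ) : (mD j).coeff 1 = -(36 * j)`. -/
theorem coeff_mD_one (j : ℤ) : (mD j).coeff 1 = -(36 * j) := by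
  rw [mD]; simp only [coeff_add, coeff_C_mul_X_pow, coeff_C_mul_X, coeff_C]; norm_num
/-- `(j : ℤ) : (mD j).coeff 0 = -(36 * j + 12)`. -/
theorem coeff_mD_zero (j : ℤ) : (mD j).coeff 0 = -(36 * j + 12) := by
  rw [mD]; simp only [coeff_add, coeff_C_mul_X_pow, coeff_C_mul_X, coeff_C]; norm_num
/-- `(j : ℤ) : (mD j).natDegree ≤ 5`. -/
theorem natDegree_mD_le (j : ℤ) : (mD j).natDegree ≤ 5 := by unfold mD; compute_degree
/-- `(j : ℤ) : (mD j).natDegree = 5` — ODD: ONE point at infinity, GENUS `(5 − 1)/2 = 2`. -/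
theorem natDegree_mD (j : ℤ) : (mD j).natDegree = 5 :=
  le_antisymm (natDegree_mD_le j) (le_natDegree_of_ne_zero (by rw [coeff_mD_five]; norm_num))
/-- `(j : ℤ) : (mD j).leadingCoeff = -4`. -/
theorem leadingCoeff_mD (j : ℤ) : (mD j).leadingCoeff = -4 := by rw [leadingCoeff, natDegree_mD, coeff_mD_five]

/-- **`Δ_j` IS 3-EISENSTEIN FOR EVERY `j ∈ ℤ`** (`3 ∤ −4`; `3 ∣ 0, 0, 9, 36j, 36j + 12`; `9 ∤ 36j + 12`) — the UNIFORM
SEPARABILITY CERTIFICATE of the class (pattern of node 22's `isEisensteinAt_sD`, here with NO congruence proviso). -/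
theorem isEisensteinAt_mD (j : ℤ) : (mD j).IsEisensteinAt (Ideal.span {(3 : ℤ)}) := by
  refine ⟨?_, fun {n} hn => ?_, ?_⟩
  · rw [leadingCoeff_mD, Ideal.mem_span_singleton]; omega
  · rw [natDegree_mD] at hn
    rw [Ideal.mem_span_singleton]
    interval_cases n
    · rw [coeff_mD_zero]; exact ⟨-(12 * j + 4), by ring⟩
    · rw [coeff_mD_one]; exact ⟨-(12 * j), by ring⟩
    · rw [coeff_mD_two]; norm_num
    · rw [coeff_mD_three]; norm_num
    · rw [coeff_mD_four]; norm_num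
  · rw [Ideal.span_singleton_pow, Ideal.mem_span_singleton, coeff_mD_zero]; omega
/-- `Δ_j` is PRIMITIVE (its content divides `−4` and `9`, coprime). -/
theorem isPrimitive_mD (j : ℤ) : (mD j).IsPrimitive := by
  intro r hr
  rw [C_dvd_iff_dvd_coeff] at hr
  have h5 : r ∣ -4 := by have := hr 5; rwa [coeff_mD_five] at this
  have h2 : r ∣ 9 := by have := hr 2; rwa [coeff_mD_two] at this
  exact (show IsCoprime (-4 : ℤ) 9 from ⟨2, 1, by norm_num⟩).isUnit_of_dvd' h5 h2
/-- **`Δ_j` is IRREDUCIBLE in `ℤ[Y]`** for every `j` … -/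
theorem irreducible_mD (j : ℤ) : Irreducible (mD j) :=
  (isEisensteinAt_mD j).irreducible ((Ideal.span_singleton_prime (by norm_num)).mpr
    (Int.prime_iff_natAbs_prime.mpr (by norm_num))) (isPrimitive_mD j) (by rw [natDegree_mD]; norm_num)
/-- **… hence IRREDUCIBLE OVER `ℚ`** (Gauss) … -/
theorem irreducible_mD_rat (j : ℤ) : Irreducible ((mD j).map (Int.castRingHom ℚ)) :=
  (IsPrimitive.Int.irreducible_iff_irreducible_map_cast (isPrimitive_mD j)).mp (irreducible_mD j)
/-- **… hence SEPARABLE over `ℚ`**: `u² = Δ_j(Y)` is a smooth affine model of a GENUS-TWO curve, uniformly in `j`. -/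
theorem separable_mD_rat (j : ℤ) : ((mD j).map (Int.castRingHom ℚ)).Separable := (irreducible_mD_rat j).separable
/-- `(j : ℤ) : 3 ≤ (mD j).natDegree`. -/
theorem three_le_natDegree_mD (j : ℤ) : 3 ≤ (mD j).natDegree := by rw [natDegree_mD]; norm_num

/-- **DOMINANCE**: `deg c₁ = 1 < 5`, `deg c₂ = 0 < 5` — `DomZero 2 (mC j)` for every `j`. -/
theorem domZero_mC (j : ℤ) : DomZero 2 (mC j) := by
  intro i hi1 hi2
  rw [mC_zero, natDegree_mQ]
  interval_cases i
  · rw [mC_one]; exact lt_of_le_of_lt (natDegree_C_mul_le _ _) (by rw [natDegree_X]; norm_num)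
  · rw [mC_two, natDegree_one]; norm_num
/-- the engine's separability hypothesis for `M j`, uniformly in `j` (3-Eisenstein). -/
theorem separable_pDisc_mC (j : ℤ) : ((pDisc (mC j)).map (Int.castRingHom ℚ)).Separable := by
  rw [pDisc_mC]; exact separable_mD_rat j
/-- the engine's degree hypothesis for `M j`. -/
theorem three_le_natDegree_pDisc_mC (j : ℤ) : 3 ≤ (pDisc (mC j)).natDegree := by
  rw [pDisc_mC]; exact three_le_natDegree_mD j
/-- **`M j ∈ DomHyper` for every `j ∈ ℤ`** — the class membership, by the uniform certificate. -/
theorem domHyper_M (j : ℤ) : DomHyper (M j) :=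
  (domHyper_xPolyP_iff (mC j) (mC_two_ne_zero j)).mpr
    ⟨domZero_mC j, separable_pDisc_mC j, three_le_natDegree_pDisc_mC j⟩

/-- **`∀ j, LevelFinite (M j)`** — HYPOTHESIS-FREE (Siegel's theorem for `u² = Δ_j(Y)`, a theorem of §L). -/
theorem levelFinite_M (j : ℤ) : LevelFinite (M j) :=
  levelFinite_dom2 (mC j) (domZero_mC j) (separable_pDisc_mC j) (three_le_natDegree_pDisc_mC j)
/-- **`∀ j m₀, ThinFibreAt m₀ (M j)`** — EVERY quality (in particular the residual `m₀ = 2`), hypothesis-free. -/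
theorem thinFibreAt_M (j : ℤ) (m₀ : ℕ) : ThinFibreAt m₀ (M j) :=
  thinFibreAt_dom2 (mC j) (domZero_mC j) (separable_pDisc_mC j) (three_le_natDegree_pDisc_mC j) m₀
/-- `(j : ℤ) : BddLevelEmpty (M j)`. -/
theorem bddLevelEmpty_M (j : ℤ) : BddLevelEmpty (M j) :=
  bddLevelEmpty_dom2 (mC j) (domZero_mC j) (separable_pDisc_mC j) (three_le_natDegree_pDisc_mC j)
/-- **`∀ j, SiegelClause (M j)`** — the record's residual binder DISCHARGED on every member. -/
theorem siegelClause_M (j : ℤ) : SiegelClause (M j) :=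
  siegelClause_dom2 (mC j) (domZero_mC j) (separable_pDisc_mC j) (three_le_natDegree_pDisc_mC j)
/-- `(j : ℤ)` : all but finitely many levels of `M j` carry NO rational point (level `1` carries `(1, −1)`: `s₁ = 1`). -/
theorem finite_pointed_levels_M (j : ℤ) : {N : ℕ | ∃ r : ℚ, bev (M j) (partialSum 2 N) r = 0}.Finite :=
  finite_pointed_levels_dom2 (mC j) (domZero_mC j) (separable_pDisc_mC j) (three_le_natDegree_pDisc_mC j)
/-- `(j : ℤ)` : finitely many rational points of `M j` with dyadic abscissa. -/
theorem finite_dyadicPoints_M (j : ℤ) : {p : ℚ × ℚ | IsDyadic p.1 ∧ bev (M j) p.1 p.2 = 0}.Finite :=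
  finite_dyadicPoints_dom2 (mC j) (domZero_mC j) (separable_pDisc_mC j) (three_le_natDegree_pDisc_mC j)
/-- `(j : ℤ)` : finitely many level ORDINATES of `M j`. -/
theorem finite_ordinates_M (j : ℤ) : {r : ℚ | ∃ N : ℕ, bev (M j) (partialSum 2 N) r = 0}.Finite :=
  (finite_ordinates_dom2 (mC j) (domZero_mC j) (separable_pDisc_mC j) (three_le_natDegree_pDisc_mC j)).subset
    fun r ⟨N, h⟩ => ⟨sQ N, isDyadic_sQ N, by rwa [M, sQ_cast] at *⟩

end Family

end Summit.Schanuel.Schanuel.Theorems.RootDecomp1KHyperellipticSiegel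

end
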